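import Summits.BirchSwinnertonDyer.BirchSwinnertonDyer.Theses.UniversalToricDescent
import Summits.BirchSwinnertonDyer.BirchSwinnertonDyer.Theorems.UniversalToricDescentToricTransportModThreeStubRatDescent
import Summits.BirchSwinnertonDyer.BirchSwinnertonDyer.Theorems.UniversalToricDescentThinCombDefs
import Summits.BirchSwinnertonDyer.BirchSwinnertonDyer.Theorems.UniversalToricDescentThinCombPencilRigidity
import Summits.BirchSwinnertonDyer.BirchSwinnertonDyer.Theorems.UniversalToricDescentAdditiveSplitIMCInclusionAtThreeStubCharIdealPrincipal
import Summits.BirchSwinnertonDyer.BirchSwinnertonDyer.Theorems.UniversalToricDescentAdditiveSplitIMCInclusionAtThreeStubFrame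
import Summits.BirchSwinnertonDyer.BirchSwinnertonDyer.Theorems.UniversalToricDescentAdditiveSplitIMCInclusionAtThreeStubTorsionTransfer
import Summits.BirchSwinnertonDyer.BirchSwinnertonDyer.Theorems.UniversalToricDescentThinCombLineValue
import Summits.BirchSwinnertonDyer.BirchSwinnertonDyer.Theorems.UniversalToricDescentCharIdealVacuity
import Summits.BirchSwinnertonDyer.BirchSwinnertonDyer.Theorems.UniversalToricDescentThinCombNoPseudoNullOfPoitouTate
import Summits.BirchSwinnertonDyer.BirchSwinnertonDyer.Theorems.SignedBaseChangeAnticyclotomicEisensteinDivisibilityXGrTwoModuleFinite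
import Summits.BirchSwinnertonDyer.Rank1Residual.X2.HidaLimitCongruenceAlgebra
import Literature.NumberTheory.EllipticCurves.TwoVariableSelmerDual
import Literature.NumberTheory.EllipticCurves.ZpExtensionSplitPrimeLineThroughPair
import Literature.NumberTheory.EllipticCurves.ToricTwoVariablePAdicLFunctionUpTo
import Summits.BirchSwinnertonDyer.BirchSwinnertonDyer.Theorems.EisensteinPrimesPoitouTateShaNaturalAtTC
import Summits.BirchSwinnertonDyer.BirchSwinnertonDyer.Theorems.UniversalToricDescentRatwallThinCombContRigidityUpTo
import Summits.BirchSwinnertonDyer.BirchSwinnertonDyer.Theorems.UniversalToricDescentRatwallThinCombContRigidityUpToTwoGradings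
import HarnessLib

/-!
# The RATIONAL WALL `RationalSplitIMCInclusionAtThree` (stmt-BirchSwinnertonDyer-24207) CLOSED MODULO A DIFFERENT TRIPLE —
# toric existence (♯♯, NO functional equation) ⊕ K2-rat ⊕ `μ = 0` ON THE BOTTOM TOOTH: NO reflection, NO frame involution, and an
# INTEGRAL two-variable divisibility on the way (helper, `--supports stmt-BirchSwinnertonDyer-24207`; cell `pub/bsd-wall`,
# LEAD `cruxlead-24207` g6; line of record stays `ratwall_thin_comb` v7)

WHY THIS FILE (LEAD-CENSUS-g6 §1; pencil audit P1 of `Cruxes/RationalSplitIMCInclusionAtThree/LENS-MEMO-utd-idea-g63.md` §2.1, now a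
tree theorem `…ThinComb.PencilRigidity.dvd_of_thinCombDvdRat_of_not_mem`). The rigidity step of the line of record consumes TWO functional
equations (K4 `stub_charIdealSymmUpTo2`: Hao–Lim 2026 (c); K3(iii) inside `stub_toricExistsSymmUpTo2`: Hao–Loeffler 2025 Thm. 4.9) ONLY
to kill the prime factors of `G = Ch_{Λ₂}(X₂)` inside the comb's bad ideal `(3, T₂)`. If `G ∉ (3, T₂)` — equivalently (coefficientwise,
`PencilRigidity.mem_span_const_T₂_iff`) the reduction of `G` to the BOTTOM TOOTH `T₂ = 0` has `μ = 0` — then ONE rational comb (K2-rat)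
already forces `G ∣ L₂` INTEGRALLY (no `3`-power slack at all), and the rest of the composition (torsion dichotomy, ♯♯ cross-period
rigidity, line congruence, no-pseudo-null, rational descent p703976) is unchanged. So the crux closes from the three hypotheses

* `hK3a` = v6's `stub_toricExistsUpTo2` VERBATIM (∃ ♯♯-frame `L₂`, `IsToricTwoVarLFunctionUpTo₂ C X Y …`; PRINT-ADJACENT at `p = 3`:
  Hao–Loeffler 2025 Thm. 3.5; NO symmetry clause — Thm. 4.9 is not used);
* `hK2` = v7's `stub_ratCombDvdUpTo2` VERBATIM (rational thin-comb divisibility; OPEN: Gu 2025 Conj. 2.15);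
* `hμ` = **BOTTOM-TOOTH `μ = 0`**: in every 𝔭-adapted frame (`κ₁` unramified outside `𝔭`) with `X₂ = X_{∅𝔭, str𝔭′}(E/K̃_∞)` finitely
  generated and torsion over `Λ₂ = ℤ₃⟦T₂⟧⟦T₁⟧` and `Ch_{Λ₂}(X₂) = (g)`: `g ∉ (3, T₂)`. Since `(3, T₂)` is an ideal the condition depends on
  `Ch(X₂)` only. IWASAWA MEANING: the bottom tooth `T₂ = 0` is the line of characters trivial on `γ₂`, i.e. of the `κ₁`-extension
  `K^𝔭_∞` (the `ℤ₃`-extension unramified outside `𝔭`); modulo the control theorem for `X₂ ↠ X₂/T₂X₂`, `g ∉ (3, T₂)` says that the Selmer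
  group of `E` over `K^𝔭_∞` with NO condition at `𝔭` and the STRICT condition at `𝔭′` is `Λ`-cotorsion with `μ = 0`; the same `μ` is read on
  EVERY tooth `T₂ = ζ − 1` (all reduce to the same element of `𝔽̄₃⟦T₁⟧`). Its residual datum (`∅` at `𝔭`, `0` at `𝔭′`) depends on `E[3]`
  alone, so it is TRANSPORTABLE from any `3`-congruent twin `E′` up to the usual control terms — the route's own mod-3 currency; there is
  NO print anchor for it at an additive split `3` (memo §2.1, Q2: no hits), and none is claimed.

What this door does NOT use, compared with v7 (`…ClosedModuloV7`): the frame involution `(c, τ, A_τ)`, `…ThinComb.FrameInvolution`,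
`…GroupLikeReflection`, Part VII `dvd_pow_mul_of_weakReflection`, Hao–Lim (c), Hao–Loeffler Thm. 4.9. What it uses instead:
`PencilRigidity.map_map_toUnr_dvd_of_thinCombDvdRat_of_not_mem` (one visible pencil over `R₀`, the bottom condition transported along
`ℤ₃ → R₀`). READING: 24207 ALSO = research {K2-rat} ⊕ print-adjacent {HL25 Thm. 3.5: K3a♯♯} ⊕ research {bottom-tooth μ = 0} ⊕ print {∅} —
an ALTERNATIVE to the v7 reading (research {K2-rat} ⊕ print-adjacent {HL25 3.5 + 4.9} ⊕ print-adjacent {Hao–Lim (c)}); the LEAD keeps v7 as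
the line of record (the functional equations are PORTS of printed theorems; the bottom-tooth `μ = 0` is not in print) and records this
door for the planners (a `μ`-line for the rational wall, and — because the divisibility obtained is INTEGRAL — for the integral wall
20395 as well, where it would replace the slack-free comb). HONEST FRAMING: conditional (closure.modulo) on three statements for which
this file is no evidence; it credits nothing by itself; no summit statement and no case of BSD is proved; 24207 OPEN.
-/

set_option linter.dupNamespace false
set_option autoImplicit false

noncomputable section

open scoped Classical

namespace Summit.BirchSwinnertonDyer.BirchSwinnertonDyer.Theorems.UniversalToricDescentRatwallThinCombLine

open NumberField IsDedekindDomain Field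
open Literature.NumberTheory.EllipticCurves Literature.NumberTheory.GaloisRepresentations
open Literature.NumberTheory.EllipticCurves.ModularForms
open Summit.BirchSwinnertonDyer.BirchSwinnertonDyer.Theorems.UniversalToricDescentThinComb

/-- **The rational wall from toric existence (♯♯, no symmetry), K2-rat and the bottom-tooth `μ = 0` ALONE** — no functional equation,
no reflection: `hK3a` (v6 `stub_toricExistsUpTo2` verbatim), `hK2` (v7 `stub_ratCombDvdUpTo2` verbatim), `hμ` (`Ch_{Λ₂}(X₂) = (g)` with
`g ∉ (3, T₂)` in every 𝔭-adapted frame with `X₂` f.g. torsion) as hypotheses; everything else — frame, principal generator, torsion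
dichotomy, ♯♯ cross-period rigidity, line congruence, ONE-PENCIL rigidity (`PencilRigidity.map_map_toUnr_dvd_of_thinCombDvdRat_of_not_mem`,
giving `G ∣ L₂` with NO slack), no-pseudo-null (Milne ADT I 4.10 (a) proved in the kernel), rational descent — is a tree theorem.
Conditional; closes nothing by itself.
[cite: HaoLoeffler2025, Thm. 3.5 (arXiv:2405.12611)] [cite: Gu2025FiniteSlopeUniversalRS, Conj. 2.15 (arXiv:2512.01184)]
[cite: Washington1997, §7.1–§7.2 and §13.4] [cite: MilneADT2006, I Thm. 4.10 (a) (p. 57)] -/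
theorem RationalSplitIMCInclusionAtThree_of_toricExistsUpTo2_of_ratCombDvd_of_bottomMu
    (hK3a :
        ∀ (W : WeierstrassCurve ℚ) [W.IsElliptic] [W.IsGloballyMinimal] (N : ℕ) [NeZero N] (K : Type) [Field K]
          [NumberField K] (Dt : Literature.NumberTheory.EllipticCurves.ModularForms.ModularParametrizationData W N),
        Summit.BirchSwinnertonDyer.Rank1Residual.Additive.ClassO6 W 3 → W.HasSurjectiveModNGaloisRep 3 →
        W.analyticRank = 1 → W.conductorNorm ℤ = N → IsImaginaryQuadratic K → SatisfiesHeegnerHypothesis N K →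
        ∀ (κ : ZpExtension K 3), κ.IsAnticyclotomic → ∀ (γ : Field.absoluteGaloisGroup K) [Fact (κ.IsTopGenerator γ)]
          (𝔭 : HeightOneSpectrum (𝓞 K)), ((3 : ℕ) : 𝓞 K) ∈ 𝔭.asIdeal →
          𝔭.asIdeal.ramificationIdx (𝓞 ℚ) = 1 → 𝔭.asIdeal.inertiaDeg (𝓞 ℚ) = 1 →
        ∀ (𝔭' : HeightOneSpectrum (𝓞 K)), ((3 : ℕ) : 𝓞 K) ∈ 𝔭'.asIdeal → 𝔭' ≠ 𝔭 →
        ∀ (ι' : PadicAlgCl 3 ≃+* ℂ), Summit.BirchSwinnertonDyer.BirchSwinnertonDyer.Theorems.SchneiderFree.BranchInducesPrime 3 ι' 𝔭 →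
        ∀ (κ₁ κ₂ : ZpExtension K 3) (γ₁ γ₂ : Field.absoluteGaloisGroup K) (k : ℕ)
          [Fact (ZpExtension.IsTopGeneratorPair κ₁ κ₂ γ₁ γ₂)],
        (∀ v : HeightOneSpectrum (𝓞 K), v ≠ 𝔭 → ∀ 𝔓 ∈ v.primesAbove,
            𝔓.inertia (Field.absoluteGaloisGroup K) ≤ κ₁.kerSubgroup) →
        ZpExtension.pairKer κ₁ κ₂ ≤ κ.kerSubgroup → γ₁ * γ⁻¹ ∈ κ.kerSubgroup → γ₂ * (γ ^ (3 ^ k))⁻¹ ∈ κ.kerSubgroup →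
        ∃ (ΩK' : ℂ) (C X Y : ℂ_[3]) (L₂ : PowerSeries (PowerSeries (unrIntegers 3))),
          ΩK' ≠ 0 ∧ C ≠ 0 ∧ X ≠ 0 ∧ Y ≠ 0 ∧
          IsToricTwoVarLFunctionUpTo₂ C X Y ι' 𝔭 𝔭' κ₁ κ₂ γ₁ γ₂ Dt.f ΩK' L₂)
    (hK2 :
        ∀ (W : WeierstrassCurve ℚ) [W.IsElliptic] [W.IsGloballyMinimal] (N : ℕ) [NeZero N] (K : Type) [Field K]
          [NumberField K] (Dt : Literature.NumberTheory.EllipticCurves.ModularForms.ModularParametrizationData W N),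
        Summit.BirchSwinnertonDyer.Rank1Residual.Additive.ClassO6 W 3 → W.HasSurjectiveModNGaloisRep 3 →
        W.analyticRank = 1 → W.conductorNorm ℤ = N → IsImaginaryQuadratic K → SatisfiesHeegnerHypothesis N K →
        ∀ (𝔭 : HeightOneSpectrum (𝓞 K)), ((3 : ℕ) : 𝓞 K) ∈ 𝔭.asIdeal →
          𝔭.asIdeal.ramificationIdx (𝓞 ℚ) = 1 → 𝔭.asIdeal.inertiaDeg (𝓞 ℚ) = 1 →
        ∀ (𝔭' : HeightOneSpectrum (𝓞 K)), ((3 : ℕ) : 𝓞 K) ∈ 𝔭'.asIdeal → 𝔭' ≠ 𝔭 →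
        ∀ (ι' : PadicAlgCl 3 ≃+* ℂ), Summit.BirchSwinnertonDyer.BirchSwinnertonDyer.Theorems.SchneiderFree.BranchInducesPrime 3 ι' 𝔭 →
        ∀ (κ₁ κ₂ : ZpExtension K 3) (γ₁ γ₂ : Field.absoluteGaloisGroup K)
          [Fact (ZpExtension.IsTopGeneratorPair κ₁ κ₂ γ₁ γ₂)],
        (∀ v : HeightOneSpectrum (𝓞 K), v ≠ 𝔭 → ∀ 𝔓 ∈ v.primesAbove,
            𝔓.inertia (Field.absoluteGaloisGroup K) ≤ κ₁.kerSubgroup) →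
        Module.Finite (IwasawaAlgebra₂ 3) ((W.baseChange K).XGr₂ 3 κ₁ κ₂ 𝔭' γ₁ γ₂) →
        Module.IsTorsion (IwasawaAlgebra₂ 3) ((W.baseChange K).XGr₂ 3 κ₁ κ₂ 𝔭' γ₁ γ₂) →
        ∀ (g : IwasawaAlgebra₂ 3),
          Literature.NumberTheory.EllipticCurves.Module.charIdeal (IwasawaAlgebra₂ 3)
            ((W.baseChange K).XGr₂ 3 κ₁ κ₂ 𝔭' γ₁ γ₂) = Ideal.span {g} →
        ∀ (ΩK' : ℂ) (C X Y : ℂ_[3]) (L₂ : PowerSeries (PowerSeries (unrIntegers 3))), ΩK' ≠ 0 → C ≠ 0 → X ≠ 0 → Y ≠ 0 →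
          IsToricTwoVarLFunctionUpTo₂ C X Y ι' 𝔭 𝔭' κ₁ κ₂ γ₁ γ₂ Dt.f ΩK' L₂ →
        ThinCombDvdRat (unrIntegers 3) 3
          (PowerSeries.map (PowerSeries.map (Summit.BirchSwinnertonDyer.Rank1Residual.X11b.Halves.toUnr 3)) g) L₂)
    (hμ :
        ∀ (W : WeierstrassCurve ℚ) [W.IsElliptic] [W.IsGloballyMinimal] (N : ℕ) [NeZero N] (K : Type) [Field K]
          [NumberField K] (Dt : Literature.NumberTheory.EllipticCurves.ModularForms.ModularParametrizationData W N),
        Summit.BirchSwinnertonDyer.Rank1Residual.Additive.ClassO6 W 3 → W.HasSurjectiveModNGaloisRep 3 →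
        W.analyticRank = 1 → W.conductorNorm ℤ = N → IsImaginaryQuadratic K → SatisfiesHeegnerHypothesis N K →
        ∀ (𝔭 : HeightOneSpectrum (𝓞 K)), ((3 : ℕ) : 𝓞 K) ∈ 𝔭.asIdeal →
          𝔭.asIdeal.ramificationIdx (𝓞 ℚ) = 1 → 𝔭.asIdeal.inertiaDeg (𝓞 ℚ) = 1 →
        ∀ (𝔭' : HeightOneSpectrum (𝓞 K)), ((3 : ℕ) : 𝓞 K) ∈ 𝔭'.asIdeal → 𝔭' ≠ 𝔭 →
        ∀ (κ₁ κ₂ : ZpExtension K 3) (γ₁ γ₂ : Field.absoluteGaloisGroup K)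
          [Fact (ZpExtension.IsTopGeneratorPair κ₁ κ₂ γ₁ γ₂)],
        (∀ v : HeightOneSpectrum (𝓞 K), v ≠ 𝔭 → ∀ 𝔓 ∈ v.primesAbove,
            𝔓.inertia (Field.absoluteGaloisGroup K) ≤ κ₁.kerSubgroup) →
        Module.Finite (IwasawaAlgebra₂ 3) ((W.baseChange K).XGr₂ 3 κ₁ κ₂ 𝔭' γ₁ γ₂) →
        Module.IsTorsion (IwasawaAlgebra₂ 3) ((W.baseChange K).XGr₂ 3 κ₁ κ₂ 𝔭' γ₁ γ₂) →
        ∀ (g : IwasawaAlgebra₂ 3),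
          Literature.NumberTheory.EllipticCurves.Module.charIdeal (IwasawaAlgebra₂ 3)
            ((W.baseChange K).XGr₂ 3 κ₁ κ₂ 𝔭' γ₁ γ₂) = Ideal.span {g} →
        g ∉ Ideal.span {const ℤ_[3] ((3 : ℕ) : ℤ_[3]), T₂ ℤ_[3]}) :
    Summit.BirchSwinnertonDyer.BirchSwinnertonDyer.Theses.UniversalToricDescent.RationalSplitIMCInclusionAtThree := by
  intro W _ _ N _ K _ _ Dt hO6 hsurj hrk hN hK hH κ hκ γ hγ 𝔭 h3 hram hdeg 𝔭' h3' hne ι' hι ΩK Ωp L hΩK hΩp hL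
  obtain ⟨κ₁, κ₂, γ₁, γ₂, k, hpair, hur₁, hker, hγ₁, hγ₂⟩ :=
    Summit.BirchSwinnertonDyer.BirchSwinnertonDyer.Theorems.UniversalToricDescentThinCombLine.stub_frame
      K hK κ hκ γ hγ.out 𝔭 h3 𝔭' h3' hne
  haveI : Fact (ZpExtension.IsTopGeneratorPair κ₁ κ₂ γ₁ γ₂) := ⟨hpair⟩
  obtain ⟨g₂, hg₂⟩ :=
    Summit.BirchSwinnertonDyer.BirchSwinnertonDyer.Theorems.UniversalToricDescentThinCombLine.stub_charIdealPrincipal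
      ((W.baseChange K).XGr₂ 3 κ₁ κ₂ 𝔭' γ₁ γ₂)
  have hg₂' : Literature.NumberTheory.EllipticCurves.Module.charIdeal (IwasawaAlgebra₂ 3)
      ((W.baseChange K).XGr₂ 3 κ₁ κ₂ 𝔭' γ₁ γ₂) = Ideal.span {g₂} := by
    simpa [Ideal.submodule_span_eq] using hg₂
  have hfin : Module.Finite (IwasawaAlgebra₂ 3) ((W.baseChange K).XGr₂ 3 κ₁ κ₂ 𝔭' γ₁ γ₂) :=
    Summit.BirchSwinnertonDyer.BirchSwinnertonDyer.Theorems.SignedBaseChangeAcDivFinitePiece.xGr₂_module_finite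
      (W.baseChange K) 3 κ₁ κ₂ 𝔭'
  -- K3a♯♯: a ♯♯-frame `L₂` (no symmetry asked)
  obtain ⟨ΩK', C, X, Y, L₂, hΩK', hC, hX, hY, hL₂⟩ :=
    hK3a W N K Dt hO6 hsurj hrk hN hK hH κ hκ γ 𝔭 h3 hram hdeg 𝔭' h3' hne ι' hι κ₁ κ₂ γ₁ γ₂ k
      hur₁ hker hγ₁ hγ₂
  -- ♯♯ cross-period rigidity WITHOUT the Rankin–Selberg continuation: `L = 0` or `3^a·spec (3^k) L₂ = 3^b·(w·L)`
  rcases Summit.BirchSwinnertonDyer.BirchSwinnertonDyer.Theorems.UniversalToricDescentRatwallThinComb.ContRigidityUpTo.eq_zero_or_rel_spec_of_toricUpTo₂_values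
      K N Dt.f hK κ hκ γ hγ.out 𝔭 h3 𝔭' h3' hne ι' κ₁ κ₂ γ₁ γ₂ k hpair hγ₁ hγ₂ hΩK hΩp hL hΩK' hC hX hY
      (fun ψ a b ha hb hinf hunr r hr hκr Lc hLd hLe ↦ hL₂.hasValueAt₂ ha hb hinf hunr hr hκr hLd hLe) with h0 | ⟨a₀, b₀, w, hw, hrel⟩
  · exact ⟨0, by rw [h0, mul_zero]; exact Ideal.zero_mem _⟩
  -- TORSION DICHOTOMY: off the torsion locus of `X₂` the rational inclusion is trivial (`Ch_Λ(X_ac) = ⊤`)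
  by_cases htors : Module.IsTorsion (IwasawaAlgebra₂ 3) ((W.baseChange K).XGr₂ 3 κ₁ κ₂ 𝔭' γ₁ γ₂)
  swap
  · have hnt := Summit.BirchSwinnertonDyer.BirchSwinnertonDyer.Theorems.UniversalToricDescentThinCombLine.stub_torsionTransfer
      W K hO6 hsurj hK κ hκ γ 𝔭 h3 𝔭' h3' hne κ₁ κ₂ γ₁ γ₂ k hur₁ hker hγ₁ hγ₂ htors
    refine ⟨0, ?_⟩
    rw [pow_zero, one_mul]
    exact (Ideal.span_singleton_le_iff_mem _).mp
      (Summit.BirchSwinnertonDyer.BirchSwinnertonDyer.Theorems.UniversalToricDescentCharIdealVacuity.span_le_map_charIdeal_of_not_isTorsion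
        hnt _ L)
  -- the comparison clause of v1 HOLDS for `L♮ := spec (3^k) L₂` with `u = 1`, `t = s = 0`
  have hcmp : ∃ (u : (PowerSeries (PowerSeries (unrIntegers 3)))ˣ) (t s : ℕ),
      const (unrIntegers 3) (((3 : ℕ) : unrIntegers 3) ^ t) * L₂ -
        u * const (unrIntegers 3) (((3 : ℕ) : unrIntegers 3) ^ s) *
          PowerSeries.map (PowerSeries.C (R := unrIntegers 3)) (TwoVarSubst.spec (3 ^ k) L₂) ∈
        Ideal.span {T₂ (unrIntegers 3) - ((1 + T₁ (unrIntegers 3)) ^ (3 ^ k) - 1)} := by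
    refine ⟨1, 0, 0, ?_⟩
    rw [pow_zero, map_one, one_mul, mul_one]
    exact LineValue.sub_one_mul_map_spec_mem_lineIdeal (3 ^ k) L₂
  -- bottom-tooth `μ = 0`: `g₂ ∉ (3, T₂)`
  have hbot := hμ W N K Dt hO6 hsurj hrk hN hK hH 𝔭 h3 hram hdeg 𝔭' h3' hne κ₁ κ₂ γ₁ γ₂ hur₁ hfin htors g₂ hg₂'
  -- K2-rat: rational thin-comb divisibility for the pinned `L₂`
  have hcomb :=
    hK2 W N K Dt hO6 hsurj hrk hN hK hH 𝔭 h3 hram hdeg 𝔭' h3' hne ι' hι κ₁ κ₂ γ₁ γ₂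
      hur₁ hfin htors g₂ hg₂' ΩK' C X Y L₂ hΩK' hC hX hY hL₂
  -- ONE VISIBLE PENCIL (tree, `…ThinComb.PencilRigidity`): `G ∣ L₂` INTEGRALLY — no reflection, no slack
  have hdvd₀ : PowerSeries.map (PowerSeries.map (Summit.BirchSwinnertonDyer.Rank1Residual.X11b.Halves.toUnr 3)) g₂ ∣ L₂ :=
    PencilRigidity.map_map_toUnr_dvd_of_thinCombDvdRat_of_not_mem 3 hbot hcomb
  have hdvd : PowerSeries.map (PowerSeries.map (Summit.BirchSwinnertonDyer.Rank1Residual.X11b.Halves.toUnr 3)) g₂ ∣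
      const (unrIntegers 3) (((3 : ℕ) : unrIntegers 3) ^ 0) * L₂ := by
    rwa [pow_zero, map_one, one_mul]
  have hPN :=
    Summit.BirchSwinnertonDyer.BirchSwinnertonDyer.Theorems.UniversalToricDescentThinComb.NoPseudoNullOfPoitouTate.stub_noPseudoNull_of_poitouTateAt
      Summit.BirchSwinnertonDyer.BirchSwinnertonDyer.Theorems.PoitouTateShaNaturalAtTC.forall_poitouTate_shaRestricted_tateDual_natural_at_of_isTotallyComplex
      W K hO6 hsurj hK κ hκ γ 𝔭 h3 𝔭' h3' hne κ₁ κ₂ γ₁ γ₂ k hur₁ hker hγ₁ hγ₂ hfin htors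
  obtain ⟨k', hk'⟩ :=
    Summit.BirchSwinnertonDyer.BirchSwinnertonDyer.Cruxes.ToricTransportModThree.RatwallThinComb.stub_ratDescent
      W K hO6 hsurj hK κ hκ γ 𝔭 h3 𝔭' h3' hne κ₁ κ₂ γ₁ γ₂ k hur₁ hker hγ₁ hγ₂ hfin htors hPN g₂ hg₂' L₂
      (TwoVarSubst.spec (3 ^ k) L₂) 0 hdvd hcmp
  -- transport from `L♮ = spec (3^k) L₂` to the handed frame along `3^a·L♮ = 3^b·(w·L)`: slack `k' + b`
  exact ⟨k' + b₀,
    Summit.BirchSwinnertonDyer.BirchSwinnertonDyer.Theorems.UniversalToricDescentRatwallThinComb.ContRigidityUpTo.pow_mul_mem_of_rel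
      hw hrel hk'⟩

end Summit.BirchSwinnertonDyer.BirchSwinnertonDyer.Theorems.UniversalToricDescentRatwallThinCombLine

end
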